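/-
Copyright (c) 2026 the pub-hodgecm-mathlib formalisation cell (harness21).  Prover seat hodgecm-mathlib-K2Liu-p06 (g3): Track B «K2-LIT»,
hLiu418 = stmt-HodgeConjecture-24832, director req649 (S1) ∕ LEAD F0P6-plan (g11) deal of record 2026-09-04T05:23:13Z = organ Φ2 of ROAD Φ
(ruling «M-155l» §2; CENSUS-41 row Φ2): file 3 «ORBIT REGROUPING»; 2026-09-04.
-/
import Summits.HodgeConjecture.HodgeConjecture.Theorems.K2LiuSiegelEisensteinCoeffOrbitVanishing   -- ★ Φ2 files 1–2
import Summits.HodgeConjecture.HodgeConjecture.Theorems.K2LiuSiegelBruhatMiddleCellDelta           -- ★ B2b `mk_eq_mk_iff_isSiegelDelta`, `mk_mul_eq_mk_iff`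
import HarnessLib

/-!
# Crux `HLiu418`, ROAD Φ, organ Φ2 (file 3): REGROUPING THE MIDDLE COSETS ALONG ONE `N_Δ(L⁺)`-ORBIT —
# `Σ_{i ∈ Stab(γ₀)\N_Δ(L⁺)} ∫ β • (conj ψ_S · f(γ₀ ν_i · h)) = ∫ β'(u) • (conj ψ_S(u) · f(γ₀ u h)) dνN(u)`, and the orbit sum VANISHES under file 2's criterion

Cell `hodgecm-mathlib`, crux item hLiu418 = `stmt-HodgeConjecture-24832`, route `HCCMUnconditional`; squad K2 ∕ K2Liu, LEAD F0P6-plan (g11 → g12), deal req649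
(S1), prover K2Liu-p06 (g3).  THEOREMS ONLY (no `def`, no instance, no notation, no named-fact hypothesis, no `sorry`); lane
`--supports stmt-HodgeConjecture-24832 --as helper` (count-neutral).

SETTING (★ file 1 `fourierCoeff_three_cells`).  The middle term of the `S`-th Fourier coefficient is `Σ'_{q ∈ REST} J_S(q)`,
`J_S(q) = ∫ β(u) • (conj ψ_S(u) · f(γ_q u h)) dνN(u)` (`γ_q = Quotient.out q`, `β` an `N_Δ(L⁺)`-covering weight).  `N_Δ(L⁺)` acts on `P_Δ(L⁺)\H(L⁺)` on the
right, `[γ] ↦ [γ ν]`; the orbit of `[γ₀]` is `{[γ₀ ν]}` with stabiliser `Stab(γ₀) = {ν : γ₀ ν γ₀⁻¹ ∈ P_Δ}` (★ B2b `mk_mul_eq_mk_iff`), so it is parametrised by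
any SECTION `i ↦ ν_i ∈ N_Δ(L⁺)` of `Stab(γ₀)\N_Δ(L⁺)` (`∀ γ, ∃! i, γ ν_i⁻¹ ∈ Stab(γ₀)`), and along it `f(γ_{[γ₀ ν]} x) = f(γ₀ ν x)` (`apply_out_orbit`).  This file
is stated over such a section (no quotient bookkeeping in the analytic statement):

* **`tsum_section_eq_integral_wt_smul`** (E2, REGROUPING): `Γ' ≤ N_Δ(L⁺)` with `γ₀ Γ' γ₀⁻¹ ⊆ P_Δ` (any subgroup of the stabiliser), `β'` a `Γ'`-covering
  weight, `ν : ι → N_Δ(L⁺)` a section of `Γ'\N_Δ(L⁺)`, and the (H)-type bound `∫⁻ (Σ'_i ‖f(γ₀ ν_i u h)‖ₑ) β dνN ≠ ∞`: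
  `Σ'_i ∫ β(u) • (conj ψ_S(u) · f(γ₀ ν_i u h)) dνN(u) = ∫ β'(u) • (conj ψ_S(u) · f(γ₀ u h)) dνN(u)`
  (★ `integral_wt_smul_eq_integral_wt_smul_tsum`; the `L¹` bound is transported by its Tonelli twin ★ `lintegral_mul_eq_lintegral_tsum_mul`; Fubini
  for series, Mathlib `integral_tsum`).
* **`tsum_section_eq_zero`** (E2 + V1′): if moreover some `s₀ ∈ N_Δ(𝔸)` has `γ₀ s₀ γ₀⁻¹ ∈ P_Δ(𝔸)` with trivial inducing character and `ψ_S(s₀) ≠ 1`, the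
  orbit sum is `0` — the whole `N_Δ(L⁺)`-orbit of `[γ₀]` contributes nothing to `E_S(h)` (★ file 2 `integral_wt_smul_conj_mul_apply_eq_zero`).
* bookkeeping for the consumer: `apply_out_orbit` (representative independence along the orbit, ★ (b) `apply_out_mk_mul`), `mk_mul_eq_mk_mul_iff`
  (`[γ₀ a] = [γ₀ b] ⟺ [γ₀ a b⁻¹] = [γ₀]`), `exists_stabilizer_subgroup` (the stabiliser as a subgroup of `N_Δ(𝔸)` with its membership law).
WHAT REMAINS for «`det S ≠ 0 ⇒ MID_S = 0`»: partition `REST` into orbits (★ Bruhat: rank of the `C`-block; organ B2c) and, for each middle `γ₀` and each `S`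
with `det S ≠ 0`, exhibit such an `s₀` (linear algebra on the corner condition ★ B2b `isSiegelDelta_conj_unip_iff`).
[MoeglinWaldspurger1995, II.1.7], [KudlaRallis1994, §2 (2.10)–(2.12)], [Tan1999, §3], [GelbartPiatetskishapiroRallis1987, Part A §2], [Garrett2018, §3.10].

HONEST LABEL.  Count-neutral helper; `HC_CM` is proved only modulo the 7 printed citations (2 remaining named inputs: hLiu418 = `stmt-HodgeConjecture-24832`,
h413 = `stmt-HodgeConjecture-24833`) until rung 0 closes.
-/

set_option autoImplicit false
set_option linter.dupNamespace false -- the mandated namespace repeats `HodgeConjecture.HodgeConjecture`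

noncomputable section

open scoped Matrix ENNReal NNReal ComplexConjugate
open NumberField IsDedekindDomain MeasureTheory MeasureTheory.Measure Filter Set Function
open Literature.NumberTheory.Automorphic Literature.NumberTheory.GaloisRepresentations
open Literature.NumberTheory.GelbartRogawski1991 Literature.NumberTheory.GelbartRogawski1991.GRConstruction
open Literature.NumberTheory.K2Lit.SiegelDoubled Literature.MeasureTheory.Group

namespace Summit.HodgeConjecture.HodgeConjecture.Cruxes.HLiu418.K2LiuSiegelEisensteinCoeffOrbitSum

open K2LiuSiegelEisensteinDoubledLeftInvariant K2LiuUnipotentCoveringWeight K2LiuConstantTermBigCellUnfold K2LiuConstantTermDelta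
  K2LiuSiegelUnipotentFourierDefs K2LiuSiegelUnipotentCharacters K2LiuSiegelFourierCoeffDelta K2LiuSiegelEisensteinCoeffCells
  K2LiuSiegelEisensteinCoeffOrbitVanishing K2LiuSiegelBruhatMiddleCellDelta K2LiuSiegelDoubledUnfold

variable {L : Type} [Field L] [NumberField L] [IsCMField L]
variable {N M n : ℕ} {e : Fin N × Fin M ≃ Fin n}
  {dV : Fin N → L} {hdV : ∀ i, IsCMField.complexConj L (dV i) = dV i}
  {dW : Fin M → L} {hdW : ∀ i, IsCMField.complexConj L (dW i) = dW i}

/-! ## §1 Bookkeeping along an orbit -/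

/-- `N_Δ(L⁺) ⊆ H(L⁺)`. [cite: MoeglinWaldspurger1995, I.2.1] -/
theorem coe_mem_ratH (ν : unipDeltaRat L e dV hdV dW hdW) : ((ν : unipDelta L e dV hdV dW hdW) : HA L e dV hdV dW hdW) ∈ ratH L e dV hdV dW hdW :=
  (mem_unipDeltaRat_iff L e dV hdV dW hdW _).1 ν.2

/-- **Representative independence along the orbit**: `f(γ_{[γ₀ ν]} x) = f(γ₀ ν x)` for a Siegel section `f`, `γ₀ ∈ H(L⁺)`, `ν ∈ N_Δ(L⁺)`
(★ (b) `apply_out_mk_mul`). [cite: Tan1999, §1] [cite: Garrett2018, §3.10] -/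
theorem apply_out_orbit {χ : HeckeCharacter L} {s : ℂ} {f : HA L e dV hdV dW hdW → ℂ} (hf : IsSiegelDeltaSection L e dV hdV dW hdW χ s f)
    (γ₀ : ratH L e dV hdV dW hdW) (ν : unipDeltaRat L e dV hdV dW hdW) (x : HA L e dV hdV dW hdW) :
    f ((((Quotient.out (Quotient.mk (MulAction.orbitRel (siegelDeltaRat L e dV hdV dW hdW) (ratH L e dV hdV dW hdW))
        (γ₀ * ⟨((ν : unipDelta L e dV hdV dW hdW) : HA L e dV hdV dW hdW), coe_mem_ratH ν⟩) :
          SiegelDeltaQuot L e dV hdV dW hdW) : ratH L e dV hdV dW hdW) : HA L e dV hdV dW hdW)) * x) =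
      f ((γ₀ : HA L e dV hdV dW hdW) * ((ν : unipDelta L e dV hdV dW hdW) : HA L e dV hdV dW hdW) * x) :=
  apply_out_mk_mul hf _ x

/-- **Cosets along an orbit**: `[γ₀ a] = [γ₀ b]` iff `[γ₀ (a b⁻¹)] = [γ₀]` (right multiplication by `b⁻¹` respects `P_Δ(L⁺)\H(L⁺)`).
[cite: MoeglinWaldspurger1995, II.1.7] -/
theorem mk_mul_eq_mk_mul_iff (γ₀ a b : ratH L e dV hdV dW hdW) :
    (Quotient.mk (MulAction.orbitRel (siegelDeltaRat L e dV hdV dW hdW) (ratH L e dV hdV dW hdW)) (γ₀ * a) : SiegelDeltaQuot L e dV hdV dW hdW) =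
        Quotient.mk (MulAction.orbitRel (siegelDeltaRat L e dV hdV dW hdW) (ratH L e dV hdV dW hdW)) (γ₀ * b) ↔
      (Quotient.mk (MulAction.orbitRel (siegelDeltaRat L e dV hdV dW hdW) (ratH L e dV hdV dW hdW)) (γ₀ * (a * b⁻¹)) : SiegelDeltaQuot L e dV hdV dW hdW) =
        Quotient.mk (MulAction.orbitRel (siegelDeltaRat L e dV hdV dW hdW) (ratH L e dV hdV dW hdW)) γ₀ := by
  rw [mk_eq_mk_iff_isSiegelDelta, mk_eq_mk_iff_isSiegelDelta]
  have h : ((γ₀ : HA L e dV hdV dW hdW)) * (((γ₀ * (a * b⁻¹) : ratH L e dV hdV dW hdW) : HA L e dV hdV dW hdW))⁻¹ =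
      ((γ₀ * b : ratH L e dV hdV dW hdW) : HA L e dV hdV dW hdW) * (((γ₀ * a : ratH L e dV hdV dW hdW) : HA L e dV hdV dW hdW))⁻¹ := by
    simp only [Subgroup.coe_mul, Subgroup.coe_inv, mul_inv_rev, inv_inv, mul_assoc]
  rw [h]

/-- **Stabiliser of `[γ₀]`**: for `ν ∈ N_Δ(L⁺)`, `[γ₀ ν] = [γ₀] ⟺ γ₀ ν γ₀⁻¹ ∈ P_Δ` (★ B2b `mk_mul_eq_mk_iff`). [cite: MoeglinWaldspurger1995, II.1.7] -/
theorem mk_mul_coe_eq_mk_iff (γ₀ : ratH L e dV hdV dW hdW) (ν : unipDeltaRat L e dV hdV dW hdW) :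
    (Quotient.mk (MulAction.orbitRel (siegelDeltaRat L e dV hdV dW hdW) (ratH L e dV hdV dW hdW))
        (γ₀ * ⟨((ν : unipDelta L e dV hdV dW hdW) : HA L e dV hdV dW hdW), coe_mem_ratH ν⟩) : SiegelDeltaQuot L e dV hdV dW hdW) =
        Quotient.mk (MulAction.orbitRel (siegelDeltaRat L e dV hdV dW hdW) (ratH L e dV hdV dW hdW)) γ₀ ↔
      IsSiegelDelta L e dV hdV dW hdW ((γ₀ : HA L e dV hdV dW hdW) * ((ν : unipDelta L e dV hdV dW hdW) : HA L e dV hdV dW hdW) *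
        ((γ₀ : HA L e dV hdV dW hdW))⁻¹) :=
  mk_mul_eq_mk_iff γ₀ _

/-- **The stabiliser `Stab(γ₀) = {ν ∈ N_Δ(L⁺) : γ₀ ν γ₀⁻¹ ∈ P_Δ}` as a subgroup of `N_Δ(𝔸)`** (existence with its membership law).
[cite: MoeglinWaldspurger1995, II.1.7] -/
theorem exists_stabilizer_subgroup (γ₀ : ratH L e dV hdV dW hdW) :
    ∃ Γ' : Subgroup (unipDelta L e dV hdV dW hdW), ∀ u : unipDelta L e dV hdV dW hdW,
      u ∈ Γ' ↔ (u : HA L e dV hdV dW hdW) ∈ ratH L e dV hdV dW hdW ∧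
        IsSiegelDelta L e dV hdV dW hdW ((γ₀ : HA L e dV hdV dW hdW) * (u : HA L e dV hdV dW hdW) * ((γ₀ : HA L e dV hdV dW hdW))⁻¹) := by
  have hconj : ∀ x y : HA L e dV hdV dW hdW, (γ₀ : HA L e dV hdV dW hdW) * (x * y) * ((γ₀ : HA L e dV hdV dW hdW))⁻¹ =
      ((γ₀ : HA L e dV hdV dW hdW) * x * ((γ₀ : HA L e dV hdV dW hdW))⁻¹) * ((γ₀ : HA L e dV hdV dW hdW) * y * ((γ₀ : HA L e dV hdV dW hdW))⁻¹) :=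
    fun x y => by simp only [mul_assoc, inv_mul_cancel_left]
  have hinv : ∀ x : HA L e dV hdV dW hdW, (γ₀ : HA L e dV hdV dW hdW) * x⁻¹ * ((γ₀ : HA L e dV hdV dW hdW))⁻¹ =
      ((γ₀ : HA L e dV hdV dW hdW) * x * ((γ₀ : HA L e dV hdV dW hdW))⁻¹)⁻¹ := fun x => by simp only [mul_inv_rev, inv_inv, mul_assoc]
  refine ⟨{ carrier := {u | (u : HA L e dV hdV dW hdW) ∈ ratH L e dV hdV dW hdW ∧
              IsSiegelDelta L e dV hdV dW hdW ((γ₀ : HA L e dV hdV dW hdW) * (u : HA L e dV hdV dW hdW) * ((γ₀ : HA L e dV hdV dW hdW))⁻¹)}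
            one_mem' := ⟨one_mem _, by
              rw [OneMemClass.coe_one, mul_one, mul_inv_cancel]; exact isSiegelDelta_one' L e dV hdV dW hdW⟩
            mul_mem' := fun {a b} ha hb => ⟨mul_mem ha.1 hb.1, by
              have hab : (((a * b : unipDelta L e dV hdV dW hdW)) : HA L e dV hdV dW hdW) = (a : HA L e dV hdV dW hdW) * (b : HA L e dV hdV dW hdW) := rfl
              rw [hab, hconj]; exact isSiegelDelta_mul L e dV hdV dW hdW ha.2 hb.2⟩
            inv_mem' := fun {a} ha => ⟨inv_mem ha.1, by
              have hai : (((a⁻¹ : unipDelta L e dV hdV dW hdW)) : HA L e dV hdV dW hdW) = ((a : HA L e dV hdV dW hdW))⁻¹ := rfl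
              rw [hai, hinv]; exact isSiegelDelta_inv L e dV hdV dW hdW ha.2⟩ }, fun u => Iff.rfl⟩

/-! ## §2 Regrouping along one orbit, over a section of `Stab(γ₀)\N_Δ(L⁺)` -/

section Orbit

variable [MeasurableSpace (unipDelta L e dV hdV dW hdW)] [BorelSpace (unipDelta L e dV hdV dW hdW)]

omit [MeasurableSpace (unipDelta L e dV hdV dW hdW)] [BorelSpace (unipDelta L e dV hdV dW hdW)] in
/-- the translate `u ↦ f(γ₀ (γ u) h)` is unchanged by `γ ∈ Γ'` when `γ₀ Γ' γ₀⁻¹ ⊆ P_Δ(L⁺)` (the conjugate is a RATIONAL Siegel element; ★ #10b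
`apply_siegelDeltaRat_mul`). [cite: MoeglinWaldspurger1995, II.1.7] -/
theorem apply_translate_subgroup_mul {χ : HeckeCharacter L} {s : ℂ} {f : HA L e dV hdV dW hdW → ℂ} (hf : IsSiegelDeltaSection L e dV hdV dW hdW χ s f)
    (γ₀ : ratH L e dV hdV dW hdW) (h : HA L e dV hdV dW hdW) (Γ' : Subgroup (unipDelta L e dV hdV dW hdW))
    (hΓ'rat : ∀ γ ∈ Γ', ((γ : unipDelta L e dV hdV dW hdW) : HA L e dV hdV dW hdW) ∈ ratH L e dV hdV dW hdW)
    (hΓ'P : ∀ γ ∈ Γ', IsSiegelDelta L e dV hdV dW hdW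
      ((γ₀ : HA L e dV hdV dW hdW) * ((γ : unipDelta L e dV hdV dW hdW) : HA L e dV hdV dW hdW) * ((γ₀ : HA L e dV hdV dW hdW))⁻¹))
    {γ : unipDelta L e dV hdV dW hdW} (hγ : γ ∈ Γ') (u : unipDelta L e dV hdV dW hdW) :
    f ((γ₀ : HA L e dV hdV dW hdW) * (((γ * u : unipDelta L e dV hdV dW hdW)) : HA L e dV hdV dW hdW) * h) =
      f ((γ₀ : HA L e dV hdV dW hdW) * (u : HA L e dV hdV dW hdW) * h) := by
  have hrat : (γ₀ : HA L e dV hdV dW hdW) * ((γ : unipDelta L e dV hdV dW hdW) : HA L e dV hdV dW hdW) * ((γ₀ : HA L e dV hdV dW hdW))⁻¹ ∈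
      ratH L e dV hdV dW hdW := mul_mem (mul_mem γ₀.2 (hΓ'rat γ hγ)) (inv_mem γ₀.2)
  set p : siegelDeltaRat L e dV hdV dW hdW := ⟨⟨_, hrat⟩, Subgroup.mem_subgroupOf.2 ((mem_siegelDelta_iff L e dV hdV dW hdW _).2 (hΓ'P γ hγ))⟩ with hp
  have hconj : (γ₀ : HA L e dV hdV dW hdW) * (((γ * u : unipDelta L e dV hdV dW hdW)) : HA L e dV hdV dW hdW) * h =
      ((γ₀ : HA L e dV hdV dW hdW) * ((γ : unipDelta L e dV hdV dW hdW) : HA L e dV hdV dW hdW) * ((γ₀ : HA L e dV hdV dW hdW))⁻¹) *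
        ((γ₀ : HA L e dV hdV dW hdW) * (u : HA L e dV hdV dW hdW) * h) := by
    rw [Subgroup.coe_mul]; simp only [mul_assoc, inv_mul_cancel_left]
  rw [hconj]
  exact apply_siegelDeltaRat_mul L e dV hdV dW hdW hf p _

set_option maxHeartbeats 400000 in
-- one long linear unfolding (Tonelli transport of the `L¹` bound, Bochner unfolding over the section, Fubini for series)
/-- **REGROUPING ALONG ONE `N_Δ(L⁺)`-ORBIT, OVER A SECTION (E2).**  `νN` left-invariant; `β` an `N_Δ(L⁺)`-covering weight; `f` a continuous Siegel section of
`I_Δ(s, χ)`; `γ₀ ∈ H(L⁺)`; `Γ' ≤ N_Δ(L⁺)` with `γ₀ Γ' γ₀⁻¹ ⊆ P_Δ` and `β'` a `Γ'`-covering weight; `ν : ι → N_Δ(L⁺)` a SECTION of `Γ'\N_Δ(L⁺)`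
(`∀ γ, ∃! i, γ ν_i⁻¹ ∈ Γ'`); and the orbit piece of (H): `∫⁻ (Σ'_i ‖f(γ₀ ν_i u h)‖ₑ) β dνN ≠ ∞`.  THEN
  `Σ'_i ∫ β(u) • (conj ψ_S(u) · f(γ₀ ν_i u h)) dνN(u) = ∫ β'(u) • (conj ψ_S(u) · f(γ₀ u h)) dνN(u)`.
With `Γ' = Stab(γ₀)` the left side is `Σ_{q ∈ O(γ₀)} J_S(q)` of ★ file 1 (`apply_out_orbit`). [cite: MoeglinWaldspurger1995, II.1.7] [cite: KudlaRallis1994, §2]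
[cite: Garrett2018, §3.10] [cite: Tan1999, §3] -/
theorem tsum_section_eq_integral_wt_smul (νN : Measure (unipDelta L e dV hdV dW hdW)) [νN.IsMulLeftInvariant]
    {β : unipDelta L e dV hdV dW hdW → ℝ≥0∞} (hβ : IsCoveringWeight (unipDeltaRat L e dV hdV dW hdW) β)
    {χ : HeckeCharacter L} {s : ℂ} {f : HA L e dV hdV dW hdW → ℂ} (hf : IsSiegelDeltaSection L e dV hdV dW hdW χ s f) (hfc : Continuous f)
    (γ₀ : ratH L e dV hdV dW hdW) (h : HA L e dV hdV dW hdW) (S : Matrix (Fin n) (Fin n) L)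
    (Γ' : Subgroup (unipDelta L e dV hdV dW hdW)) (hΓ'le : Γ' ≤ unipDeltaRat L e dV hdV dW hdW)
    (hΓ'P : ∀ γ ∈ Γ', IsSiegelDelta L e dV hdV dW hdW
      ((γ₀ : HA L e dV hdV dW hdW) * ((γ : unipDelta L e dV hdV dW hdW) : HA L e dV hdV dW hdW) * ((γ₀ : HA L e dV hdV dW hdW))⁻¹))
    {β' : unipDelta L e dV hdV dW hdW → ℝ≥0∞} (hβ' : IsCoveringWeight Γ' β')
    {ι : Type*} [Countable ι] (ν : ι → unipDeltaRat L e dV hdV dW hdW)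
    (hν : ∀ γ ∈ unipDeltaRat L e dV hdV dW hdW, ∃! i, γ * ((ν i : unipDelta L e dV hdV dW hdW))⁻¹ ∈ Γ')
    (hO : ∫⁻ u, (∑' i, ‖f ((γ₀ : HA L e dV hdV dW hdW) * (((ν i : unipDelta L e dV hdV dW hdW)) : HA L e dV hdV dW hdW) *
      ((u : HA L e dV hdV dW hdW) * h))‖ₑ) * β u ∂νN ≠ ∞) :
    ∑' i, ∫ u, (β u).toReal • (conj (unipDeltaChar L e dV hdV dW hdW S (u : HA L e dV hdV dW hdW) : ℂ) *
        f ((γ₀ : HA L e dV hdV dW hdW) * (((ν i : unipDelta L e dV hdV dW hdW)) : HA L e dV hdV dW hdW) * ((u : HA L e dV hdV dW hdW) * h))) ∂νN =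
      ∫ u, (β' u).toReal • (conj (unipDeltaChar L e dV hdV dW hdW S (u : HA L e dV hdV dW hdW) : ℂ) *
        f ((γ₀ : HA L e dV hdV dW hdW) * (u : HA L e dV hdV dW hdW) * h)) ∂νN := by
  haveI : Countable (unipDeltaRat L e dV hdV dW hdW) := countable_unipDeltaRat L e dV hdV dW hdW
  haveI : MeasurableConstSMul (unipDelta L e dV hdV dW hdW) (unipDelta L e dV hdV dW hdW) := ⟨fun g => measurable_const_mul g⟩
  haveI : SMulInvariantMeasure (unipDelta L e dV hdV dW hdW) (unipDelta L e dV hdV dW hdW) νN :=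
    ⟨fun g t _ht => by rw [show (fun x : unipDelta L e dV hdV dW hdW => g • x) ⁻¹' t = (fun x => g * x) ⁻¹' t from rfl, measure_preimage_mul]⟩
  have hΓ'rat : ∀ γ ∈ Γ', ((γ : unipDelta L e dV hdV dW hdW) : HA L e dV hdV dW hdW) ∈ ratH L e dV hdV dW hdW := fun γ hγ =>
    (mem_unipDeltaRat_iff L e dV hdV dW hdW _).1 (hΓ'le hγ)
  -- the integrand `F(u) = conj ψ_S(u) f(γ₀ u h)`, its `Γ'`-invariance, and its values along the section
  set F : unipDelta L e dV hdV dW hdW → ℂ := fun u =>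
    conj (unipDeltaChar L e dV hdV dW hdW S (u : HA L e dV hdV dW hdW) : ℂ) * f ((γ₀ : HA L e dV hdV dW hdW) * (u : HA L e dV hdV dW hdW) * h) with hFdef
  have hFm : StronglyMeasurable F := ((Complex.continuous_conj.comp (continuous_unipDeltaChar_coe L e dV hdV dW hdW S)).mul
    (hfc.comp ((continuous_const.mul continuous_subtype_val).mul continuous_const))).stronglyMeasurable
  have hFinv : ∀ γ ∈ Γ', ∀ u : unipDelta L e dV hdV dW hdW, F (γ • u) = F u := by
    intro γ hγ u
    rw [hFdef]
    dsimp only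
    rw [smul_eq_mul, ← unipDeltaChar_subgroup_smul Γ' hΓ'rat S ⟨γ, hγ⟩ u, apply_translate_subgroup_mul hf γ₀ h Γ' hΓ'rat hΓ'P hγ u]
    rfl
  have hFs : ∀ (i : ι) (u : unipDelta L e dV hdV dW hdW), F (((ν i : unipDelta L e dV hdV dW hdW)) • u) =
      conj (unipDeltaChar L e dV hdV dW hdW S (u : HA L e dV hdV dW hdW) : ℂ) *
        f ((γ₀ : HA L e dV hdV dW hdW) * (((ν i : unipDelta L e dV hdV dW hdW)) : HA L e dV hdV dW hdW) * ((u : HA L e dV hdV dW hdW) * h)) := by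
    intro i u
    rw [hFdef]
    dsimp only
    rw [smul_eq_mul, unipDeltaChar_rat_mul, Subgroup.coe_mul, ← mul_assoc, ← mul_assoc]
  -- the `L¹` bound for `F` against `β'`, transported from (H) by Tonelli unfolding
  have hint : ∫⁻ u, ‖F u‖ₑ * β' u ∂νN < ∞ := by
    have hFn : Measurable fun u => ‖F u‖ₑ := hFm.measurable.enorm
    have hFninv : ∀ γ ∈ Γ', ∀ u : unipDelta L e dV hdV dW hdW, ‖F (γ • u)‖ₑ = ‖F u‖ₑ := fun γ hγ u => by rw [hFinv γ hγ u]
    rw [lintegral_mul_eq_lintegral_tsum_mul νN (unipDeltaRat L e dV hdV dW hdW) Γ' hΓ'le hFn hFninv hβ'.1 hβ'.2 hβ.1 hβ.2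
      (s := fun i => (ν i : unipDelta L e dV hdV dW hdW)) (fun i => (ν i).2) hν]
    refine lt_of_le_of_lt (le_of_eq ?_) (lt_top_iff_ne_top.2 hO)
    refine lintegral_congr fun u => ?_
    congr 1
    refine tsum_congr fun i => ?_
    rw [hFs i u, ← ofReal_norm, norm_conj_unipDeltaChar_mul, ofReal_norm]
  -- Bochner unfolding
  have key := integral_wt_smul_eq_integral_wt_smul_tsum νN (unipDeltaRat L e dV hdV dW hdW) Γ' hΓ'le hFm hFinv hβ'.1 hβ'.2 hβ.1 hβ.2
    (s := fun i => (ν i : unipDelta L e dV hdV dW hdW)) (fun i => (ν i).2) hν hint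
  rw [show (∫ u, (β' u).toReal • (conj (unipDeltaChar L e dV hdV dW hdW S (u : HA L e dV hdV dW hdW) : ℂ) *
      f ((γ₀ : HA L e dV hdV dW hdW) * (u : HA L e dV hdV dW hdW) * h)) ∂νN) = ∫ u, wt β' u • F u ∂νN from rfl, key]
  simp_rw [hFs]
  -- Fubini for series: `∫ β • Σ'_i G_i = Σ'_i ∫ β • G_i`
  set Fq : ι → unipDelta L e dV hdV dW hdW → ℂ := fun i u =>
    f ((γ₀ : HA L e dV hdV dW hdW) * (((ν i : unipDelta L e dV hdV dW hdW)) : HA L e dV hdV dW hdW) * ((u : HA L e dV hdV dW hdW) * h)) with hFq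
  set g : ι → unipDelta L e dV hdV dW hdW → ℂ := fun i u =>
    (β u).toReal • (conj (unipDeltaChar L e dV hdV dW hdW S (u : HA L e dV hdV dW hdW) : ℂ) * Fq i u) with hg
  have hgm : ∀ i, AEStronglyMeasurable (g i) νN := fun i => aestronglyMeasurable_wt_smul_conj_mul_apply νN hβ.1 S hfc _ h
  have hgn : ∀ i u, ‖g i u‖ₑ = ‖Fq i u‖ₑ * β u := fun i u => enorm_wt_smul_conj_mul hβ S u _
  have hFqm : ∀ i, Measurable fun u => ‖Fq i u‖ₑ := fun i => measurable_enorm_apply_mul_coe_mul' hfc _ h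
  have hsum : ∑' i, ∫⁻ u, ‖g i u‖ₑ ∂νN ≠ ∞ := by
    simp_rw [hgn]
    rw [← lintegral_tsum (f := fun i u => ‖Fq i u‖ₑ * β u) fun i => ((hFqm i).mul hβ.1).aemeasurable]
    simp_rw [ENNReal.tsum_mul_right]
    exact hO
  rw [show (∑' i, ∫ u, (β u).toReal • (conj (unipDeltaChar L e dV hdV dW hdW S (u : HA L e dV hdV dW hdW) : ℂ) * Fq i u) ∂νN) =
      ∑' i, ∫ u, g i u ∂νN from rfl, ← integral_tsum hgm hsum]
  refine integral_congr_ae (ae_of_all _ fun u => ?_)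
  show (∑' i, (β u).toReal • (conj (unipDeltaChar L e dV hdV dW hdW S (u : HA L e dV hdV dW hdW) : ℂ) * Fq i u)) = wt β u • _
  rw [tsum_const_smul'' (β u).toReal]

/-- **THE ORBIT SUM VANISHES (E2 + V1′)**: in the setting of `tsum_section_eq_integral_wt_smul`, if some `s₀ ∈ N_Δ(𝔸)` has `γ₀ s₀ γ₀⁻¹ ∈ P_Δ(𝔸)` with
trivial inducing character `χ(det_Δ)|det_Δ|^{s+n/2}(γ₀ s₀ γ₀⁻¹) = 1` and `ψ_S(s₀) ≠ 1`, then
`Σ'_i ∫ β(u) • (conj ψ_S(u) · f(γ₀ ν_i u h)) dνN(u) = 0` — the whole `N_Δ(L⁺)`-orbit of `[γ₀]` contributes nothing to `E_S(h)`.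
[cite: MoeglinWaldspurger1995, II.1.7] [cite: KudlaRallis1994, §2] [cite: Tan1999, §3] -/
theorem tsum_section_eq_zero (νN : Measure (unipDelta L e dV hdV dW hdW)) [νN.IsMulLeftInvariant]
    {β : unipDelta L e dV hdV dW hdW → ℝ≥0∞} (hβ : IsCoveringWeight (unipDeltaRat L e dV hdV dW hdW) β)
    {χ : HeckeCharacter L} {s : ℂ} {f : HA L e dV hdV dW hdW → ℂ} (hf : IsSiegelDeltaSection L e dV hdV dW hdW χ s f) (hfc : Continuous f)
    (γ₀ : ratH L e dV hdV dW hdW) (h : HA L e dV hdV dW hdW) (S : Matrix (Fin n) (Fin n) L)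
    (Γ' : Subgroup (unipDelta L e dV hdV dW hdW)) [Countable Γ'] (hΓ'le : Γ' ≤ unipDeltaRat L e dV hdV dW hdW)
    (hΓ'P : ∀ γ ∈ Γ', IsSiegelDelta L e dV hdV dW hdW
      ((γ₀ : HA L e dV hdV dW hdW) * ((γ : unipDelta L e dV hdV dW hdW) : HA L e dV hdV dW hdW) * ((γ₀ : HA L e dV hdV dW hdW))⁻¹))
    {β' : unipDelta L e dV hdV dW hdW → ℝ≥0∞} (hβ' : IsCoveringWeight Γ' β')
    {ι : Type*} [Countable ι] (ν : ι → unipDeltaRat L e dV hdV dW hdW)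
    (hν : ∀ γ ∈ unipDeltaRat L e dV hdV dW hdW, ∃! i, γ * ((ν i : unipDelta L e dV hdV dW hdW))⁻¹ ∈ Γ')
    (hO : ∫⁻ u, (∑' i, ‖f ((γ₀ : HA L e dV hdV dW hdW) * (((ν i : unipDelta L e dV hdV dW hdW)) : HA L e dV hdV dW hdW) *
      ((u : HA L e dV hdV dW hdW) * h))‖ₑ) * β u ∂νN ≠ ∞)
    {s₀ : unipDelta L e dV hdV dW hdW}
    (hs₀P : IsSiegelDelta L e dV hdV dW hdW ((γ₀ : HA L e dV hdV dW hdW) * (s₀ : HA L e dV hdV dW hdW) * ((γ₀ : HA L e dV hdV dW hdW))⁻¹))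
    (hs₀χ : siegelDeltaCharacter L e dV hdV dW hdW χ s ((γ₀ : HA L e dV hdV dW hdW) * (s₀ : HA L e dV hdV dW hdW) * ((γ₀ : HA L e dV hdV dW hdW))⁻¹) = 1)
    (hs₀ : unipDeltaChar L e dV hdV dW hdW S (s₀ : HA L e dV hdV dW hdW) ≠ 1) :
    ∑' i, ∫ u, (β u).toReal • (conj (unipDeltaChar L e dV hdV dW hdW S (u : HA L e dV hdV dW hdW) : ℂ) *
        f ((γ₀ : HA L e dV hdV dW hdW) * (((ν i : unipDelta L e dV hdV dW hdW)) : HA L e dV hdV dW hdW) * ((u : HA L e dV hdV dW hdW) * h))) ∂νN = 0 := by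
  haveI : Countable (unipDeltaRat L e dV hdV dW hdW) := countable_unipDeltaRat L e dV hdV dW hdW
  haveI : MeasurableConstSMul (unipDelta L e dV hdV dW hdW) (unipDelta L e dV hdV dW hdW) := ⟨fun g => measurable_const_mul g⟩
  haveI : SMulInvariantMeasure (unipDelta L e dV hdV dW hdW) (unipDelta L e dV hdV dW hdW) νN :=
    ⟨fun g t _ht => by rw [show (fun x : unipDelta L e dV hdV dW hdW => g • x) ⁻¹' t = (fun x => g * x) ⁻¹' t from rfl, measure_preimage_mul]⟩
  have hΓ'rat : ∀ γ ∈ Γ', ((γ : unipDelta L e dV hdV dW hdW) : HA L e dV hdV dW hdW) ∈ ratH L e dV hdV dW hdW := fun γ hγ =>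
    (mem_unipDeltaRat_iff L e dV hdV dW hdW _).1 (hΓ'le hγ)
  rw [tsum_section_eq_integral_wt_smul νN hβ hf hfc γ₀ h S Γ' hΓ'le hΓ'P hβ' ν hν hO]
  refine integral_wt_smul_conj_mul_apply_eq_zero νN Γ' hΓ'rat hβ' S hf hfc γ₀ h hΓ'P ?_ hs₀P hs₀χ hs₀
  -- finiteness: `∫⁻ ‖f(γ₀ u h)‖ₑ β' = ∫⁻ (Σ'_i ‖f(γ₀ ν_i u h)‖ₑ) β` (Tonelli unfolding) `≠ ∞`
  have hFn : Measurable fun u : unipDelta L e dV hdV dW hdW => ‖f ((γ₀ : HA L e dV hdV dW hdW) * (u : HA L e dV hdV dW hdW) * h)‖ₑ :=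
    measurable_enorm_apply_mul_coe_mul hfc _ h
  have hFninv : ∀ γ ∈ Γ', ∀ u : unipDelta L e dV hdV dW hdW,
      ‖f ((γ₀ : HA L e dV hdV dW hdW) * (((γ • u : unipDelta L e dV hdV dW hdW)) : HA L e dV hdV dW hdW) * h)‖ₑ =
        ‖f ((γ₀ : HA L e dV hdV dW hdW) * (u : HA L e dV hdV dW hdW) * h)‖ₑ := fun γ hγ u => by
    rw [smul_eq_mul, apply_translate_subgroup_mul hf γ₀ h Γ' hΓ'rat hΓ'P hγ u]
  rw [lintegral_mul_eq_lintegral_tsum_mul νN (unipDeltaRat L e dV hdV dW hdW) Γ' hΓ'le hFn hFninv hβ'.1 hβ'.2 hβ.1 hβ.2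
    (s := fun i => (ν i : unipDelta L e dV hdV dW hdW)) (fun i => (ν i).2) hν]
  refine ne_of_eq_of_ne ?_ hO
  refine lintegral_congr fun u => ?_
  congr 1
  refine tsum_congr fun i => ?_
  rw [smul_eq_mul, Subgroup.coe_mul, ← mul_assoc, ← mul_assoc]

end Orbit

end Summit.HodgeConjecture.HodgeConjecture.Cruxes.HLiu418.K2LiuSiegelEisensteinCoeffOrbitSum

end
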